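import Summits.BirchSwinnertonDyer.BirchSwinnertonDyer.Theorems.ResidualThetaTransportAtTwoCmLambdaLowerOfCorank
import Summits.BirchSwinnertonDyer.BirchSwinnertonDyer.Theses.ResidualThetaTransportAtTwo
import HarnessLib

/-!
# Stub-ideation k = 3 (gen 2) for `stub_cmLambdaLower` (S2 = RSL_g, stmt-BirchSwinnertonDyer-22608) —
# «ZERO-LOCUS SPLIT»: probe the extremes of the zero locus of `L⁻_g`.

Sketch for the idea file `idea-stub_cmLambdaLower-k3.md` (planner-sidea-stub_cmLambdaLower-3-g2).
Technique: DECOMPOSITION of the fixed stub into sub-stubs with a PROVED glue.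

* §1 `cycShift`, `evenCycDivCount` — the analytic count `z⁺_B(L)`: `[T ∣ L] + Σ_(1 ≤ k ≤ B) φ(p^(2k))·[Φ_(p^(2k))(1+T) ∣ L]`
  (the even-range cyclotomic divisors of `L ∈ 𝒪⟦T⟧`; for `L = Lm` of an `IsPollackPairK` these are the zeros at
  which `Lm` interpolates central values `L(g ⊗ χ, 1)`, `χ` of level `0` or even level: `ω_n^-` has only odd-level factors).
* §2 `encard_mul_le_of_divisible` (PROVED) — the divisible snake: for `P ≤ S ≤ A`, `f : A →+ A`, `f|_P` onto `P`:
  `#P[f] · #((S/P)[f̄]) ≤ #S[f]` in `ℕ∞`; `cast_pow_le_of_le_mul` (PROVED) — the numeric recomposition.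
* §3 the three sub-stubs on the VERBATIM binders of RSL_g: `CarrierSubgroup` (𝔖, = rev-2 Step 2 / k3-g0 A0, cited not claimed),
  `EvenZeroWitness` (𝔐: a `ϖ`-divisible scalar-stable `P ⊆ Sel⁺_(S₀)` with `#P[ϖ] = q^(z⁺)` — the Bloch–Kato classes that
  BT26 Thm 3.1 (rank-zero 2-converse for CM newforms, any `p`) attaches to the even-level zeros of `Lm`, transported by `Θ`),
  `ExcessInequality` (𝔛: `q^(d + Σ_g(S₀) − z⁺) ≤ #((Sel⁺_(S₀)/P)[ϖ])` — the main-conjecture-type residue, = S2 when `z⁺ = 0`,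
  = the imprimitive increment alone when `z⁺ = d`).
* §4 `residualSignedLambdaLowerCMAtTwo_of_zeroLocusSplit : 𝔖 → 𝔐 → 𝔛 → RSL_g` (the route item BY NAME), PROVED.

Honest framing: BSD is NOT proved by any of this; 26074 and 22608 stay OPEN; 𝔐 and 𝔛 are `def … : Prop` (nothing asserted).
-/

noncomputable section

open scoped Classical

namespace Summit.BirchSwinnertonDyer.BirchSwinnertonDyer.Cruxes.ResidualThetaCountLowerPureAtTwo.StubIdeasK3g2

open Literature.NumberTheory.EllipticCurves Literature.NumberTheory.EllipticCurves.GreenbergSelmer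
open Literature.NumberTheory.GaloisRepresentations NumberField IsDedekindDomain Field

/-! ### §1. The even-range cyclotomic divisor count `z⁺_B(L)` -/

/-- `Φ_(p^m)(1 + T) ∈ 𝒪⟦T⟧` (`𝒪 = padicCoeffIntegers S`), the shifted cyclotomic polynomial whose roots are the
`ζ − 1`, `ζ` of exact order `p^m`. -/
def cycShift {p : ℕ} [Fact p.Prime] (S : Set (PadicAlgCl p)) (m : ℕ) : IwasawaAlgebraO S :=
  (((((Polynomial.cyclotomic (p ^ m) ℤ).comp (Polynomial.X + 1)).map
      (Int.castRingHom ↥(padicCoeffIntegers S))) : Polynomial ↥(padicCoeffIntegers S)) :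
    PowerSeries ↥(padicCoeffIntegers S))

/-- **`z⁺_B(L)`** — the even-range cyclotomic divisor count of `L ∈ 𝒪⟦T⟧` up to level `2B`:
`[T ∣ L]·1 + Σ_(1 ≤ k ≤ B) [Φ_(p^(2k))(1+T) ∣ L]·φ(p^(2k))`. Each summand that fires is a full Galois orbit of zeros of `L`
at `ζ − 1`, `ζ` of order `1` or `p^(2k)` — for `L = L⁻_g` (`IsPollackPairK`, even `n`: `θ_n ≡ ±ω_n^- L⁻`, `ω_n^-` = odd
levels only) exactly the levels at which `L⁻_g(ζ − 1) = c_χ · L(g ⊗ χ̄, 1)/Ω`, `c_χ ≠ 0`. An UNDER-count of the even-range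
zeros is harmless for the split (it only moves work from 𝔐 to 𝔛). -/
def evenCycDivCount {p : ℕ} [Fact p.Prime] (S : Set (PadicAlgCl p)) (B : ℕ) (L : IwasawaAlgebraO S) : ℕ :=
  (if (PowerSeries.X : IwasawaAlgebraO S) ∣ L then 1 else 0) +
    ∑ k ∈ Finset.Icc 1 B, (if cycShift S (2 * k) ∣ L then Nat.totient (p ^ (2 * k)) else 0)

/-- Level-`0` only: `z⁺_0(L) = [T ∣ L]`. -/
theorem evenCycDivCount_zero {p : ℕ} [Fact p.Prime] (S : Set (PadicAlgCl p)) (L : IwasawaAlgebraO S) :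
    evenCycDivCount S 0 L = (if (PowerSeries.X : IwasawaAlgebraO S) ∣ L then 1 else 0) := by
  simp [evenCycDivCount]

/-! ### §2. The glue, PROVED: divisible snake in `ℕ∞` and the numeric recomposition -/

/-- **Divisible snake.** `A` an additive group, `f : A →+ A`, `P ≤ S` subgroups with `f` ONTO on `P`
(`∀ y ∈ P, ∃ y' ∈ P, f y' = y`). Then `#(P ∩ ker f) · #(image in A/P of {y ∈ S | f y ∈ P}) ≤ #(S ∩ ker f)` in `ℕ∞`:
the map `S ∩ ker f → A/P` hits every class `ȳ` with `f y ∈ P` (correct `y` by a `P`-preimage of `f y`) and its fibres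
are `P ∩ ker f`-cosets; realised as an injection `(P ∩ ker f) × image ↪ S ∩ ker f`. No finiteness needed. -/
theorem encard_mul_le_of_divisible {A : Type*} [AddCommGroup A] (f : A →+ A) (S P : AddSubgroup A)
    (hPS : P ≤ S) (hdiv : ∀ y ∈ P, ∃ y' ∈ P, f y' = y) :
    {y : A | y ∈ P ∧ f y = 0}.encard *
        ((QuotientAddGroup.mk : A → A ⧸ P) '' {y : A | y ∈ S ∧ f y ∈ P}).encard ≤
      {y : A | y ∈ S ∧ f y = 0}.encard := by
  classical
  set K₀ : Set A := {y : A | y ∈ P ∧ f y = 0} with hK₀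
  set I : Set (A ⧸ P) := ((QuotientAddGroup.mk : A → A ⧸ P) '' {y : A | y ∈ S ∧ f y ∈ P}) with hI
  set K : Set A := {y : A | y ∈ S ∧ f y = 0} with hK
  have hsec : ∀ i : I, ∃ y : A, y ∈ K ∧ (QuotientAddGroup.mk y : A ⧸ P) = (i : A ⧸ P) := by
    rintro ⟨i, y, ⟨hyS, hfy⟩, rfl⟩
    obtain ⟨y', hy'P, hfy'⟩ := hdiv (f y) hfy
    refine ⟨y - y', ⟨S.sub_mem hyS (hPS hy'P), by simp [map_sub, hfy']⟩, ?_⟩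
    rw [QuotientAddGroup.mk_sub, (QuotientAddGroup.eq_zero_iff y').mpr hy'P, sub_zero]
  choose sec hsecK hsecmk using hsec
  let F : K₀ × I → K := fun ki =>
    ⟨sec ki.2 + (ki.1 : A),
      ⟨S.add_mem (hsecK ki.2).1 (hPS ki.1.2.1), by simp [map_add, (hsecK ki.2).2, ki.1.2.2]⟩⟩
  have hF : Function.Injective F := by
    rintro ⟨⟨k₁, hk₁⟩, i₁⟩ ⟨⟨k₂, hk₂⟩, i₂⟩ h
    have h' : sec i₁ + k₁ = sec i₂ + k₂ := congrArg Subtype.val h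
    have hi : (i₁ : A ⧸ P) = (i₂ : A ⧸ P) := by
      have := congrArg (QuotientAddGroup.mk : A → A ⧸ P) h'
      simpa [QuotientAddGroup.mk_add, hsecmk, (QuotientAddGroup.eq_zero_iff k₁).mpr hk₁.1,
        (QuotientAddGroup.eq_zero_iff k₂).mpr hk₂.1] using this
    have hi' : i₁ = i₂ := Subtype.ext hi
    subst hi'
    have hk : k₁ = k₂ := add_left_cancel h'
    subst hk
    rfl
  calc K₀.encard * I.encard = ENat.card K₀ * ENat.card I := by simp [ENat.card_coe_set_eq]
    _ = ENat.card (K₀ × I) := (ENat.card_prod _ _).symm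
    _ ≤ ENat.card K := ENat.card_le_card_of_injective hF
    _ = K.encard := ENat.card_coe_set_eq K

/-- **Numeric recomposition.** From `#P[ϖ] = q^z` (used as the left factor), `q^(a − z) ≤ Y` and `q^z · Y ≤ T` with `1 ≤ T`,
conclude `q^a ≤ T` in `ℕ∞` (the case `q = 0` is only bookkeeping: `q = #(𝒪/ϖ)` is a `Nat.card`). -/
theorem cast_pow_le_of_le_mul {q a z : ℕ} {Y T : ℕ∞} (hT1 : 1 ≤ T)
    (hY : ((q ^ (a - z) : ℕ) : ℕ∞) ≤ Y) (hglue : ((q ^ z : ℕ) : ℕ∞) * Y ≤ T) :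
    ((q ^ a : ℕ) : ℕ∞) ≤ T := by
  rcases Nat.eq_zero_or_pos q with hq | hq
  · subst hq
    rcases Nat.eq_zero_or_pos a with ha | ha
    · subst ha; simpa using hT1
    · simp [Nat.zero_pow ha]
  · calc ((q ^ a : ℕ) : ℕ∞) ≤ ((q ^ z * q ^ (a - z) : ℕ) : ℕ∞) := by
          exact_mod_cast (Nat.pow_le_pow_right hq le_add_tsub).trans_eq (pow_add q z (a - z))
      _ = ((q ^ z : ℕ) : ℕ∞) * ((q ^ (a - z) : ℕ) : ℕ∞) := by push_cast; ring
      _ ≤ ((q ^ z : ℕ) : ℕ∞) * Y := by gcongr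
      _ ≤ T := hglue

/-! ### §3. The three sub-stubs, on the VERBATIM binders of RSL_g (`def … : Prop`; nothing asserted) -/

/-- **𝔖 `CarrierSubgroup`** (support; = STUB-PLAN rev 2 Step 2 / card k3-g0 `A0`, CITED here, not claimed): the transported
`S₀`-imprimitive plus-Selmer SET of RSL_g is (the carrier of) an additive subgroup of `H¹(ℚ_∞, A_g)` stable under the
`𝒪`-scalars `scalarH1`. Kernel content: integral Schur at `2` (`ThetaTransport.decomp_equivariant_addMonoidHom_pi_primary_eq_sum_nsmul`,
Serre item 27793 CLOSED) makes the plus condition `𝒪`-linear. -/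
def CarrierSubgroup : Prop :=
  open Literature.NumberTheory.EllipticCurves GreenbergSelmer GreenbergVatsal2000 Kobayashi2003 ModularForms Rank1Residual Literature.NumberTheory.GaloisRepresentations Literature.NumberTheory.Automorphic IsDedekindDomain NumberField Field Rat.HeightOneSpectrum PowerSeries in ∀ (W : WeierstrassCurve ℚ) [W.IsElliptic] [W.IsGloballyMinimal], ¬ W.HasCM → W.analyticRank = 0 → GoodSS W 2 → W.frobeniusTrace 2 = 0 → W.Δ < 0 → ∀ (M : ℕ) [NeZero M] (g : CuspForm (CongruenceSubgroup.Gamma0 M) 2) (ι : coeffField g →+* PadicAlgCl 2) (Ω : ℂ), Odd M → IsNewform0 g → IsCMForm (liftToGamma1 M 2 g) → cuspCoeff g 2 = 0 → IsCohomologicalPlusPeriod g ι Ω → (∀ ℓ : ℕ, ℓ.Prime → ¬ ℓ ∣ 2 * M * W.conductorNorm ℤ → ‖embCoeff g ι ℓ - (W.frobeniusTrace ℓ : PadicAlgCl 2)‖ < 1) → ∀ (κ : ZpExtension ℚ 2) (γ : absoluteGaloisGroup ℚ), κ.IsCyclotomic → κ.IsTopGenerator γ → IsCyclotomicVariable 2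 γ → ∀ (S₀ : Finset (HeightOneSpectrum (RingOfIntegers ℚ))), (∀ v ∈ S₀, ((2 : ℕ) : RingOfIntegers ℚ) ∉ v.asIdeal) → (∀ v, ¬ W.HasGoodReductionAt v → v ∈ S₀) → (∀ v, natGenerator v ∣ M → v ∈ S₀) → ∀ (Lp Lm : IwasawaAlgebraO (Set.range ι)) (d : ℕ), IsPollackPairK g ι Ω Lp Lm → (∀ k, ‖coeff k (iwasawaOToPowerSeries (Set.range ι) Lm)‖ ≤ ‖coeff d (iwasawaOToPowerSeries (Set.range ι) Lm)‖) → (∀ k < d, ‖coeff k (iwasawaOToPowerSeries (Set.range ι) Lm)‖ < ‖coeff d (iwasawaOToPowerSeries (Set.range ι) Lm)‖) → ∀ (n : ℕ) (ρ : FramedGaloisRep ℚ ↥(padicCoeffIntegers (Set.range ι)) 2) (Θ : ∀ v : HeightOneSpectrum (RingOfIntegers ℚ), ((2 : ℕ) : RingOfIntegers ℚ) ∈ v.asIdeal → (Cofree ρ ↥(padicCoeffField (Set.range ι)) ≃+ (Fin n → ↥(W.geomPrimaryTorsion 2)))), (∀ v, ¬ natGenerator v ∣ 2 * M → ρ.IsUnramifiedAt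 v ∧ ∃ P : Polynomial ↥(padicCoeffIntegers (Set.range ι)), P.map (padicCoeffIntegers (Set.range ι)).subtype = Polynomial.X ^ 2 - Polynomial.C (embCoeff g ι (natGenerator v)) * Polynomial.X + Polynomial.C ((natGenerator v : ℕ) : PadicAlgCl 2) ∧ ρ.HasFrobCharpolyAt v P) → (∀ v hv (δ : absoluteGaloisGroup (v.adicCompletion ℚ)) m i, Θ v hv (resGalOfEmb (closureEmb (K := ℚ) (v.adicCompletion ℚ)) δ • m) i = resGalOfEmb (closureEmb (K := ℚ) (v.adicCompletion ℚ)) δ • Θ v hv m i) → ∀ (ϖ : ↥(padicCoeffIntegers (Set.range ι))), Irreducible ϖ → ∃ S𝒮 : AddSubgroup (subgroupH1 κ.kerSubgroup (Cofree ρ ↥(padicCoeffField (Set.range ι)))), (S𝒮 : Set (subgroupH1 κ.kerSubgroup (Cofree ρ ↥(padicCoeffField (Set.range ι))))) = {y : subgroupH1 κ.kerSubgroup (Cofree ρ ↥(padicCoeffField (Set.range ι))) | y ∈ unramifiedOutside κ.kerSubgroup (Cofree ρ ↥(padicCoeffField (Set.range ι))) 2 ↑S₀ ∧ (∀ w σ,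 conjH1 κ.kerSubgroup (Cofree ρ ↥(padicCoeffField (Set.range ι))) σ y ∈ infKer κ.kerSubgroup (Cofree ρ ↥(padicCoeffField (Set.range ι))) w) ∧ (∀ v hv σ, ∃ (φ : _) (Q : Fin n → localPoints W (v.adicCompletion ℚ)) (k : ℕ), oneCocycleClass (discreteTopRep ↥κ.kerSubgroup (Cofree ρ ↥(padicCoeffField (Set.range ι)))) φ = conjH1 κ.kerSubgroup (Cofree ρ ↥(padicCoeffField (Set.range ι))) σ y ∧ (∀ i, (2 ^ k) • Q i ∈ ⨆ m : ℕ, signedLocalPoints κ (v.adicCompletion ℚ) W 1 m) ∧ ∀ τ i, pointsMapOfEmb W (closureEmb (K := ℚ) (v.adicCompletion ℚ)) (((Θ v hv (φ.1 (resGalSubgroupOfEmb κ.kerSubgroup (closureEmb (K := ℚ) (v.adicCompletion ℚ)) τ))) i : ↥(W.geomPrimaryTorsion 2)) : W.geomPoints) = (τ : absoluteGaloisGroup (v.adicCompletion ℚ)) • Q i - Q i)} ∧ ∀ (r : ↥(padicCoeffIntegers (Set.range ι))) (y : subgroupH1 κ.kerSubgroup (Cofree ρ ↥(padicCoeffField (Set.range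 ι)))), y ∈ S𝒮 → scalarH1 κ.kerSubgroup (Cofree ρ ↥(padicCoeffField (Set.range ι))) r y ∈ S𝒮

/-- **𝔐 `EvenZeroWitness`** (sub-stub, the PRINT-CLOSED extreme): there is a `ϖ`-DIVISIBLE, `𝒪`-stable additive subgroup
`P` of the plus-Selmer set with `#P[ϖ] = q^(z⁺)`, `z⁺ = evenCycDivCount (range ι) d Lm` (even-range cyclotomic divisors of
`L⁻_g` up to level `2d`). Mechanism: each firing level `m ∈ {0} ∪ 2ℕ⁺` means `L⁻_g(ζ − 1) = 0` for all `ζ` of order `2^m`, i.e.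
(`IsPollackPairK`, even `n`) `L(g ⊗ χ̄, 1) = 0` for every `χ` of level `m`; BT26 Thm 3.1 (rank-zero `p`-converse for CM newforms,
ANY prime `p`, applied to the CM newform attached to `g ⊗ χ̄` at the prime of `F(χ)` over `ι`) gives `H¹_f(ℚ, V_g ⊗ χ̄) ≠ 0`; Shapiro `⊗ ℚ`
puts these classes in the `χ̄`-part of `H¹_f(ℚ_m, V_g)`, of total `𝒪`-corank `≥ φ(2^m)` per firing level; their divisible
images in `H¹(ℚ_∞, A_g)` are unramified outside `2`, vacuous at `∞`, and satisfy the PLUS condition at `2` because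
`H¹_f(ℚ_(2,m), V_g) = (Ŵ(𝔪_m) ⊗ ℚ)^n` through `Θ` (Bloch–Kato Ex. 3.11 for `W`, `V_g ≅ V₂W^n` on `G_(ℚ₂)`) and even-level isotypic
local points lie in `E⁺_m ⊗ ℚ₂` (Kobayashi §8 / CSCAN S4: `E⁺_m ⊗ ℚ₂ = ⊕_(level 0 ∪ even) ℚ₂(χ)`); a sub-witness of corank EXACTLY
`z⁺` is then chosen inside. Why it might fail: the plus-membership of even-level BK classes at `p = 2` with `𝒪`-coefficients is a
port (Kobayashi is `p` odd; CSCAN is kit evidence `j313722/j313729`), and BT26 3.1 ⊗ℚ must be matched with the INTEGRAL lattice `ρ`. -/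
def EvenZeroWitness : Prop :=
  open Literature.NumberTheory.EllipticCurves GreenbergSelmer GreenbergVatsal2000 Kobayashi2003 ModularForms Rank1Residual Literature.NumberTheory.GaloisRepresentations Literature.NumberTheory.Automorphic IsDedekindDomain NumberField Field Rat.HeightOneSpectrum PowerSeries in ∀ (W : WeierstrassCurve ℚ) [W.IsElliptic] [W.IsGloballyMinimal], ¬ W.HasCM → W.analyticRank = 0 → GoodSS W 2 → W.frobeniusTrace 2 = 0 → W.Δ < 0 → ∀ (M : ℕ) [NeZero M] (g : CuspForm (CongruenceSubgroup.Gamma0 M) 2) (ι : coeffField g →+* PadicAlgCl 2) (Ω : ℂ), Odd M → IsNewform0 g → IsCMForm (liftToGamma1 M 2 g) → cuspCoeff g 2 = 0 → IsCohomologicalPlusPeriod g ι Ω → (∀ ℓ : ℕ, ℓ.Prime → ¬ ℓ ∣ 2 * M * W.conductorNorm ℤ → ‖embCoeff g ι ℓ - (W.frobeniusTrace ℓ : PadicAlgCl 2)‖ < 1) → ∀ (κ : ZpExtension ℚ 2) (γ : absoluteGaloisGroup ℚ), κ.IsCyclotomic → κ.IsTopGenerator γ → IsCyclotomicVariable 2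 γ → ∀ (S₀ : Finset (HeightOneSpectrum (RingOfIntegers ℚ))), (∀ v ∈ S₀, ((2 : ℕ) : RingOfIntegers ℚ) ∉ v.asIdeal) → (∀ v, ¬ W.HasGoodReductionAt v → v ∈ S₀) → (∀ v, natGenerator v ∣ M → v ∈ S₀) → ∀ (Lp Lm : IwasawaAlgebraO (Set.range ι)) (d : ℕ), IsPollackPairK g ι Ω Lp Lm → (∀ k, ‖coeff k (iwasawaOToPowerSeries (Set.range ι) Lm)‖ ≤ ‖coeff d (iwasawaOToPowerSeries (Set.range ι) Lm)‖) → (∀ k < d, ‖coeff k (iwasawaOToPowerSeries (Set.range ι) Lm)‖ < ‖coeff d (iwasawaOToPowerSeries (Set.range ι) Lm)‖) → ∀ (n : ℕ) (ρ : FramedGaloisRep ℚ ↥(padicCoeffIntegers (Set.range ι)) 2) (Θ : ∀ v : HeightOneSpectrum (RingOfIntegers ℚ), ((2 : ℕ) : RingOfIntegers ℚ) ∈ v.asIdeal → (Cofree ρ ↥(padicCoeffField (Set.range ι)) ≃+ (Fin n → ↥(W.geomPrimaryTorsion 2)))), (∀ v, ¬ natGenerator v ∣ 2 * M → ρ.IsUnramifiedAt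 v ∧ ∃ P : Polynomial ↥(padicCoeffIntegers (Set.range ι)), P.map (padicCoeffIntegers (Set.range ι)).subtype = Polynomial.X ^ 2 - Polynomial.C (embCoeff g ι (natGenerator v)) * Polynomial.X + Polynomial.C ((natGenerator v : ℕ) : PadicAlgCl 2) ∧ ρ.HasFrobCharpolyAt v P) → (∀ v hv (δ : absoluteGaloisGroup (v.adicCompletion ℚ)) m i, Θ v hv (resGalOfEmb (closureEmb (K := ℚ) (v.adicCompletion ℚ)) δ • m) i = resGalOfEmb (closureEmb (K := ℚ) (v.adicCompletion ℚ)) δ • Θ v hv m i) → ∀ (ϖ : ↥(padicCoeffIntegers (Set.range ι))), Irreducible ϖ → ∃ P : AddSubgroup (subgroupH1 κ.kerSubgroup (Cofree ρ ↥(padicCoeffField (Set.range ι)))), (P : Set (subgroupH1 κ.kerSubgroup (Cofree ρ ↥(padicCoeffField (Set.range ι))))) ⊆ {y : subgroupH1 κ.kerSubgroup (Cofree ρ ↥(padicCoeffField (Set.range ι))) | y ∈ unramifiedOutside κ.kerSubgroup (Cofree ρ ↥(padicCoeffField (Set.range ι))) 2 ↑S₀ ∧ (∀ w σ, conjH1 κ.kerSubgroup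 (Cofree ρ ↥(padicCoeffField (Set.range ι))) σ y ∈ infKer κ.kerSubgroup (Cofree ρ ↥(padicCoeffField (Set.range ι))) w) ∧ (∀ v hv σ, ∃ (φ : _) (Q : Fin n → localPoints W (v.adicCompletion ℚ)) (k : ℕ), oneCocycleClass (discreteTopRep ↥κ.kerSubgroup (Cofree ρ ↥(padicCoeffField (Set.range ι)))) φ = conjH1 κ.kerSubgroup (Cofree ρ ↥(padicCoeffField (Set.range ι))) σ y ∧ (∀ i, (2 ^ k) • Q i ∈ ⨆ m : ℕ, signedLocalPoints κ (v.adicCompletion ℚ) W 1 m) ∧ ∀ τ i, pointsMapOfEmb W (closureEmb (K := ℚ) (v.adicCompletion ℚ)) (((Θ v hv (φ.1 (resGalSubgroupOfEmb κ.kerSubgroup (closureEmb (K := ℚ) (v.adicCompletion ℚ)) τ))) i : ↥(W.geomPrimaryTorsion 2)) : W.geomPoints) = (τ : absoluteGaloisGroup (v.adicCompletion ℚ)) • Q i - Q i)} ∧ (∀ (r : ↥(padicCoeffIntegers (Set.range ι))) (y : subgroupH1 κ.kerSubgroup (Cofree ρ ↥(padicCoeffField (Set.range ι)))), y ∈ P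 → scalarH1 κ.kerSubgroup (Cofree ρ ↥(padicCoeffField (Set.range ι))) r y ∈ P) ∧ (∀ y ∈ P, ∃ y' ∈ P, scalarH1 κ.kerSubgroup (Cofree ρ ↥(padicCoeffField (Set.range ι))) ϖ y' = y) ∧ {y : subgroupH1 κ.kerSubgroup (Cofree ρ ↥(padicCoeffField (Set.range ι))) | y ∈ P ∧ scalarH1 κ.kerSubgroup (Cofree ρ ↥(padicCoeffField (Set.range ι))) ϖ y = 0}.encard = ((Nat.card (↥(padicCoeffIntegers (Set.range ι)) ⧸ Ideal.span {ϖ}) ^ evenCycDivCount (Set.range ι) d Lm : ℕ) : ℕ∞)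

/-- **𝔛 `ExcessInequality`** (sub-stub, the main-conjecture-type RESIDUE): for every carrier `S𝒮` of the plus-Selmer set and
every `ϖ`-divisible `𝒪`-stable `P ≤ S𝒮` with `#P[ϖ] = q^(z⁺)`, the quotient `S𝒮/P` has at least `q^(d + Σ_g(S₀) − z⁺)` classes
`ȳ` with `ϖ y ∈ P`. Content: `λ_𝒪` of the dual of `S𝒮/P` is `λ(X⁺_(S₀)) − z⁺`, so 𝔛 is «`λ(X⁺_(S₀)) ≥ d + Σ_g(S₀)`» with the
`z⁺` even-range cyclotomic zeros REMOVED from both sides: the EXCESS zeros of `L⁻_g` (odd-level, non-cyclotomic, multiple) plus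
the imprimitive increment. Extremes: `z⁺ = 0` ⇒ 𝔛 = S2 (nothing gained, honest); `z⁺ = d` (every `2`-adic zero of `L⁻_g` is a
simple even-level cyclotomic zero — the showcase `(W, g) = (19a1, 361a1)` if `λ(L⁻_361a1) = 1`) ⇒ 𝔛 = the `Σ_g(S₀)`-increment over
`S𝒮/P` alone (GV-type surjectivity; needs `X⁺_∅` torsion ⟸ Kato 12.4/12.5(1) ⊗ port, NOT the CM equality half BT26 2.6 / JLK 5.7).
Why it might fail: as S2 — it IS S2's MC content on the excess locus (route kill criteria unchanged). -/
def ExcessInequality : Prop :=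
  open Literature.NumberTheory.EllipticCurves GreenbergSelmer GreenbergVatsal2000 Kobayashi2003 ModularForms Rank1Residual Literature.NumberTheory.GaloisRepresentations Literature.NumberTheory.Automorphic IsDedekindDomain NumberField Field Rat.HeightOneSpectrum PowerSeries in ∀ (W : WeierstrassCurve ℚ) [W.IsElliptic] [W.IsGloballyMinimal], ¬ W.HasCM → W.analyticRank = 0 → GoodSS W 2 → W.frobeniusTrace 2 = 0 → W.Δ < 0 → ∀ (M : ℕ) [NeZero M] (g : CuspForm (CongruenceSubgroup.Gamma0 M) 2) (ι : coeffField g →+* PadicAlgCl 2) (Ω : ℂ), Odd M → IsNewform0 g → IsCMForm (liftToGamma1 M 2 g) → cuspCoeff g 2 = 0 → IsCohomologicalPlusPeriod g ι Ω → (∀ ℓ : ℕ, ℓ.Prime → ¬ ℓ ∣ 2 * M * W.conductorNorm ℤ → ‖embCoeff g ι ℓ - (W.frobeniusTrace ℓ : PadicAlgCl 2)‖ < 1) → ∀ (κ : ZpExtension ℚ 2) (γ : absoluteGaloisGroup ℚ), κ.IsCyclotomic → κ.IsTopGenerator γ → IsCyclotomicVariable 2 γ → ∀ (S₀ : Finset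 (HeightOneSpectrum (RingOfIntegers ℚ))), (∀ v ∈ S₀, ((2 : ℕ) : RingOfIntegers ℚ) ∉ v.asIdeal) → (∀ v, ¬ W.HasGoodReductionAt v → v ∈ S₀) → (∀ v, natGenerator v ∣ M → v ∈ S₀) → ∀ (Lp Lm : IwasawaAlgebraO (Set.range ι)) (d : ℕ), IsPollackPairK g ι Ω Lp Lm → (∀ k, ‖coeff k (iwasawaOToPowerSeries (Set.range ι) Lm)‖ ≤ ‖coeff d (iwasawaOToPowerSeries (Set.range ι) Lm)‖) → (∀ k < d, ‖coeff k (iwasawaOToPowerSeries (Set.range ι) Lm)‖ < ‖coeff d (iwasawaOToPowerSeries (Set.range ι) Lm)‖) → ∀ (n : ℕ) (ρ : FramedGaloisRep ℚ ↥(padicCoeffIntegers (Set.range ι)) 2) (Θ : ∀ v : HeightOneSpectrum (RingOfIntegers ℚ), ((2 : ℕ) : RingOfIntegers ℚ) ∈ v.asIdeal → (Cofree ρ ↥(padicCoeffField (Set.range ι)) ≃+ (Fin n → ↥(W.geomPrimaryTorsion 2)))), (∀ v, ¬ natGenerator v ∣ 2 * M → ρ.IsUnramifiedAt v ∧ ∃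 P : Polynomial ↥(padicCoeffIntegers (Set.range ι)), P.map (padicCoeffIntegers (Set.range ι)).subtype = Polynomial.X ^ 2 - Polynomial.C (embCoeff g ι (natGenerator v)) * Polynomial.X + Polynomial.C ((natGenerator v : ℕ) : PadicAlgCl 2) ∧ ρ.HasFrobCharpolyAt v P) → (∀ v hv (δ : absoluteGaloisGroup (v.adicCompletion ℚ)) m i, Θ v hv (resGalOfEmb (closureEmb (K := ℚ) (v.adicCompletion ℚ)) δ • m) i = resGalOfEmb (closureEmb (K := ℚ) (v.adicCompletion ℚ)) δ • Θ v hv m i) → ∀ (ϖ : ↥(padicCoeffIntegers (Set.range ι))), Irreducible ϖ → ∀ (S𝒮 P : AddSubgroup (subgroupH1 κ.kerSubgroup (Cofree ρ ↥(padicCoeffField (Set.range ι))))), (S𝒮 : Set (subgroupH1 κ.kerSubgroup (Cofree ρ ↥(padicCoeffField (Set.range ι))))) = {y : subgroupH1 κ.kerSubgroup (Cofree ρ ↥(padicCoeffField (Set.range ι))) | y ∈ unramifiedOutside κ.kerSubgroup (Cofree ρ ↥(padicCoeffField (Set.range ι))) 2 ↑S₀ ∧ (∀ w σ, conjH1 κ.kerSubgroup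 (Cofree ρ ↥(padicCoeffField (Set.range ι))) σ y ∈ infKer κ.kerSubgroup (Cofree ρ ↥(padicCoeffField (Set.range ι))) w) ∧ (∀ v hv σ, ∃ (φ : _) (Q : Fin n → localPoints W (v.adicCompletion ℚ)) (k : ℕ), oneCocycleClass (discreteTopRep ↥κ.kerSubgroup (Cofree ρ ↥(padicCoeffField (Set.range ι)))) φ = conjH1 κ.kerSubgroup (Cofree ρ ↥(padicCoeffField (Set.range ι))) σ y ∧ (∀ i, (2 ^ k) • Q i ∈ ⨆ m : ℕ, signedLocalPoints κ (v.adicCompletion ℚ) W 1 m) ∧ ∀ τ i, pointsMapOfEmb W (closureEmb (K := ℚ) (v.adicCompletion ℚ)) (((Θ v hv (φ.1 (resGalSubgroupOfEmb κ.kerSubgroup (closureEmb (K := ℚ) (v.adicCompletion ℚ)) τ))) i : ↥(W.geomPrimaryTorsion 2)) : W.geomPoints) = (τ : absoluteGaloisGroup (v.adicCompletion ℚ)) • Q i - Q i)} → P ≤ S𝒮 → (∀ (r : ↥(padicCoeffIntegers (Set.range ι))) (y : subgroupH1 κ.kerSubgroup (Cofree ρ ↥(padicCoeffField (Set.range ι)))),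 y ∈ P → scalarH1 κ.kerSubgroup (Cofree ρ ↥(padicCoeffField (Set.range ι))) r y ∈ P) → (∀ y ∈ P, ∃ y' ∈ P, scalarH1 κ.kerSubgroup (Cofree ρ ↥(padicCoeffField (Set.range ι))) ϖ y' = y) → {y : subgroupH1 κ.kerSubgroup (Cofree ρ ↥(padicCoeffField (Set.range ι))) | y ∈ P ∧ scalarH1 κ.kerSubgroup (Cofree ρ ↥(padicCoeffField (Set.range ι))) ϖ y = 0}.encard = ((Nat.card (↥(padicCoeffIntegers (Set.range ι)) ⧸ Ideal.span {ϖ}) ^ evenCycDivCount (Set.range ι) d Lm : ℕ) : ℕ∞) → ((Nat.card (↥(padicCoeffIntegers (Set.range ι)) ⧸ Ideal.span {ϖ}) ^ ((d + ∑ v ∈ S₀, 2 ^ padicValNat 2 ((natGenerator v ^ 2 - 1) / 8) * (if natGenerator v ∣ M then (if ‖embCoeff g ι (natGenerator v) - 1‖ < 1 then 1 else 0) else (if ‖embCoeff g ι (natGenerator v)‖ < 1 then 2 else 0))) - evenCycDivCount (Set.range ι) d Lm) : ℕ) : ℕ∞) ≤ ((QuotientAddGroup.mk : subgroupH1 κ.kerSubgroup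 (Cofree ρ ↥(padicCoeffField (Set.range ι))) → subgroupH1 κ.kerSubgroup (Cofree ρ ↥(padicCoeffField (Set.range ι))) ⧸ P) '' {y : subgroupH1 κ.kerSubgroup (Cofree ρ ↥(padicCoeffField (Set.range ι))) | y ∈ S𝒮 ∧ scalarH1 κ.kerSubgroup (Cofree ρ ↥(padicCoeffField (Set.range ι))) ϖ y ∈ P}).encard

/-! ### §4. Recomposition to the route item BY NAME (PROVED) -/

set_option maxHeartbeats 2000000 in
/-- **RSL_g ⟸ 𝔖 ∧ 𝔐 ∧ 𝔛.** On every S2 datum: take the carrier `S𝒮` (𝔖) and the witness `P ⊆ S𝒮` (𝔐), apply 𝔛 to `(S𝒮, P)`,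
and recompose with the divisible snake `encard_mul_le_of_divisible` for `f = scalarH1 ϖ` and `cast_pow_le_of_le_mul`:
`q^(d+Σ) ≤ q^(z⁺) · q^(d+Σ−z⁺) ≤ #P[ϖ] · #((S𝒮/P)[ϖ]) ≤ #S𝒮[ϖ] = #𝒮[ϖ]`. The conclusion is the route decl
`Theses.ResidualThetaTransportAtTwo.ResidualSignedLambdaLowerCMAtTwo` (= `stub_cmLambdaLower` v6 by name). -/
theorem residualSignedLambdaLowerCMAtTwo_of_zeroLocusSplit
    (h𝔖 : CarrierSubgroup) (h𝔐 : EvenZeroWitness) (h𝔛 : ExcessInequality) :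
    Summit.BirchSwinnertonDyer.BirchSwinnertonDyer.Theses.ResidualThetaTransportAtTwo.ResidualSignedLambdaLowerCMAtTwo := by
  unfold Summit.BirchSwinnertonDyer.BirchSwinnertonDyer.Theses.ResidualThetaTransportAtTwo.ResidualSignedLambdaLowerCMAtTwo
  intro W _ _ hCM hr0 hss ha2 hΔ M _ g ι Ω hM hnew hcmf ha2g hΩ hcong κ γ hκ hγ hcyc S₀ hS₀ hbad hMS Lp Lm d hpair hle hlt n ρ Θ hρ hΘ ϖ hϖ
  obtain ⟨S𝒮, hS, hSscal⟩ := h𝔖 W hCM hr0 hss ha2 hΔ M g ι Ω hM hnew hcmf ha2g hΩ hcong κ γ hκ hγ hcyc S₀ hS₀ hbad hMS Lp Lm d hpair hle hlt n ρ Θ hρ hΘ ϖ hϖ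
  obtain ⟨P, hPset, hPscal, hPdiv, hPcard⟩ := h𝔐 W hCM hr0 hss ha2 hΔ M g ι Ω hM hnew hcmf ha2g hΩ hcong κ γ hκ hγ hcyc S₀ hS₀ hbad hMS Lp Lm d hpair hle hlt n ρ Θ hρ hΘ ϖ hϖ
  have hPS : P ≤ S𝒮 := fun y hy ↦ by
    have hy' : y ∈ (S𝒮 : Set _) := by rw [hS]; exact hPset hy
    exact hy'
  have hX := h𝔛 W hCM hr0 hss ha2 hΔ M g ι Ω hM hnew hcmf ha2g hΩ hcong κ γ hκ hγ hcyc S₀ hS₀ hbad hMS Lp Lm d hpair hle hlt n ρ Θ hρ hΘ ϖ hϖ S𝒮 P hS hPS hPscal hPdiv hPcard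
  have hglue := encard_mul_le_of_divisible
    (scalarH1 κ.kerSubgroup (Cofree ρ ↥(padicCoeffField (Set.range ι))) ϖ) S𝒮 P hPS hPdiv
  rw [hPcard] at hglue
  have hT1 : (1 : ℕ∞) ≤ {y | y ∈ S𝒮 ∧ scalarH1 κ.kerSubgroup (Cofree ρ ↥(padicCoeffField (Set.range ι))) ϖ y = 0}.encard :=
    Set.one_le_encard_iff_nonempty.mpr ⟨0, S𝒮.zero_mem, map_zero _⟩
  have key := cast_pow_le_of_le_mul hT1 hX hglue
  refine le_of_le_of_eq key (congrArg Set.encard (Set.ext fun y ↦ ?_))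
  constructor
  · rintro ⟨hyS, h4⟩
    have hy : y ∈ (S𝒮 : Set _) := hyS
    rw [hS] at hy
    obtain ⟨h1, h2, h3⟩ := hy
    exact ⟨h1, h2, h3, h4⟩
  · rintro ⟨h1, h2, h3, h4⟩
    have hy : y ∈ (S𝒮 : Set _) := by rw [hS]; exact ⟨h1, h2, h3⟩
    exact ⟨hy, h4⟩

end Summit.BirchSwinnertonDyer.BirchSwinnertonDyer.Cruxes.ResidualThetaCountLowerPureAtTwo.StubIdeasK3g2

end
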